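import Mathlib
import Literature.AlgebraicGeometry.Resolution.LocalBlowup
import Literature.AlgebraicGeometry.Resolution.TranscendenceDefect
import Literature.AlgebraicGeometry.Resolution.ResolutionOfSingularities
import Literature.AlgebraicGeometry.Resolution.ResolutionLU
import Literature.AlgebraicGeometry.Resolution.ArithmeticalThreefolds
import Literature.AlgebraicGeometry.Resolution.MonomializationAlongValuation
import Literature.AlgebraicGeometry.Resolution.RsopMonomialIdeals
import Literature.AlgebraicGeometry.Resolution.QuadraticTransformsRegular
import Literature.RingTheory.KrullDimension.AffineDimension
import Literature.RingTheory.KrullDimension.LocalizationDimension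
import Literature.AlgebraicGeometry.Resolution.AffineDomainEquidim
import Literature.AlgebraicGeometry.Resolution.ExcellentRingsFieldProofs
import Literature.AlgebraicGeometry.Resolution.ExcellentRingsEssFiniteType
import Literature.AlgebraicGeometry.Resolution.LocalBlowupModels
import Summits.ResolutionOfSingularities.ResolutionOfSingularities.Theorems.RadicialJungCleanModelsCleanLU3ArcPackage
import Summits.ResolutionOfSingularities.ResolutionOfSingularities.Theorems.RadicialJungCleanModelsCleanLU3Defectless
import Summits.ResolutionOfSingularities.ResolutionOfSingularities.Theorems.RadicialJungCleanModelsLens5TwistModel2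
import Summits.ResolutionOfSingularities.ResolutionOfSingularities.Theorems.RadicialJungCleanModelsLens5PRankTwoPort1
import HarnessLib

/-!
# PORT (T-slice module map §16 (vii), part 2a) of res-B-lens-5's `Lens5_PRankTwoAssembly.lean` rev 7: helpers for PORT 2 (`valuation_eq_one_of_isUnit_of_le`,
# `centre_closed_and_dim_three_of_pow_mem` — the `d = 3` pinning kept as a separate lemma on purpose)

Author res-B-lens-5 (g10); ported verbatim by res-B-lead-1 g5.  OURS; nothing here proves resolution in characteristic `p`.
-/

noncomputable section

set_option linter.dupNamespace false -- mandated namespace of this single-conjunct summit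

open IsLocalRing
open Literature.AlgebraicGeometry.Resolution
open Summit.ResolutionOfSingularities.ResolutionOfSingularities.Theorems.RadicialJung.CleanModels.Lens5.GradedBasis
open Summit.ResolutionOfSingularities.ResolutionOfSingularities.Theorems.RadicialJung.CleanModels.Lens5.ImmediateValues
open Summit.ResolutionOfSingularities.ResolutionOfSingularities.Theorems.RadicialJung.CleanModels.Lens5.PRankTwoCurrency
open Summit.ResolutionOfSingularities.ResolutionOfSingularities.Theorems.RadicialJung.CleanModels.Lens5

namespace Summit.ResolutionOfSingularities.ResolutionOfSingularities.Theorems.RadicialJung.CleanModels.Lens5.PRankTwoAssembly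

section PortTwo

open AlgebraicGeometry CategoryTheory

/-! ### (rev 5) helper for PORT 2 — units of a subring of `O` have value `1` -/

/-- A unit of a subring `R₂ ⊆ O` of `K` has `v`-value `1`. [folklore] -/
theorem valuation_eq_one_of_isUnit_of_le {K : Type} [Field K] {R₂ : Subring K} (O : ValuationSubring K)
    (h : R₂ ≤ O.toSubring) {x : R₂} (hx : IsUnit x) : O.valuation (x : K) = 1 := by
  obtain ⟨y, hy⟩ := hx.exists_right_inv
  have hxO : O.valuation (x : K) ≤ 1 := (O.valuation_le_one_iff _).mpr (h x.2)
  have hyO : O.valuation (y : K) ≤ 1 := (O.valuation_le_one_iff _).mpr (h y.2)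
  have hxy : O.valuation (x : K) * O.valuation (y : K) = 1 := by
    rw [← map_mul, ← Subring.coe_mul, hy, Subring.coe_one, map_one]
  refine le_antisymm hxO ?_
  calc (1 : _) = O.valuation (x : K) * O.valuation (y : K) := hxy.symm
    _ ≤ O.valuation (x : K) * 1 := by gcongr
    _ = O.valuation (x : K) := mul_one _

/-- **Closed centre and dimension `3` for a model containing `p`-th powers of the generators.**  If the centre of `O` is closed on
every subring `T ⊆ O` containing `A = k[t]` (hzd), `dim A = 3`, and `A₂ ⊆ O` is a finitely generated `k`-subalgebra containing `a^p` for
every `a ∈ t` (`p > 0`), then the centre of `O` on `A₂` is maximal, `dim A₂ = 3` and `dim (locAtCentre A₂ O) = 3`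
(`A₂[t] ⊇ A` is integral over `A₂`: maximality and dimension descend; then ✓ `ringKrullDim_locAtCentre_eq_of_isMaximal`). [folklore] -/
theorem centre_closed_and_dim_three_of_pow_mem {k : Type} [Field k] {K : Type} [Field K] [Algebra k K] {p : ℕ} (hp : 0 < p)
    (O : ValuationSubring K) (A : Subalgebra k K) (hAO : A.toSubring ≤ O.toSubring) (hAfg : A.FG) [IsFractionRing A K]
    (hdimA : ringKrullDim A = 3) (t : Finset K) (ht : Algebra.adjoin k (t : Set K) = A)
    (hzd : ∀ (T : Subring K) (hT : T ≤ O.toSubring), A.toSubring ≤ T → (subringCentre T O hT).IsMaximal)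
    (A₂ : Subalgebra k K) (hA₂O : A₂.toSubring ≤ O.toSubring) (hA₂fg : A₂.FG) (hAp : ∀ a ∈ (t : Set K), a ^ p ∈ A₂) :
    (subringCentre A₂.toSubring O hA₂O).IsMaximal ∧ ringKrullDim A₂ = 3 ∧ ringKrullDim (locAtCentre A₂.toSubring O) = 3 := by
  classical
  have hk : ∀ c : k, algebraMap k K c ∈ O := fun c => hAO (A.algebraMap_mem c)
  have htA : ∀ a ∈ (t : Set K), a ∈ A := fun a ha => by rw [← ht]; exact Algebra.subset_adjoin ha
  let C : Subalgebra k K := Algebra.adjoin k ((A₂ : Set K) ∪ ↑t)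
  have hCfg : C.FG := fg_adjoin_subalgebra_union A₂ hA₂fg t
  have hA₂C : A₂ ≤ C := fun x hx => Algebra.subset_adjoin (Or.inl hx)
  have hAC : A ≤ C := by
    intro x hx
    rw [← ht] at hx
    exact Algebra.adjoin_mono Set.subset_union_right hx
  have hCO : C.toSubring ≤ O.toSubring := by
    intro x hx
    rw [Subalgebra.mem_toSubring] at hx
    change x ∈ O
    induction hx using Algebra.adjoin_induction with
    | mem x hx =>
        rcases hx with hx | hx
        · exact hA₂O hx
        · exact hAO (htA x hx)
    | algebraMap r => exact hk r
    | add x y _ _ hx hy => exact O.add_mem _ _ hx hy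
    | mul x y _ _ hx hy => exact O.mul_mem _ _ hx hy
  have hmaxC : (subringCentre C.toSubring O hCO).IsMaximal := hzd C.toSubring hCO (fun x hx => hAC hx)
  letI algAC : Algebra A₂ C := (Subalgebra.inclusion hA₂C).toRingHom.toAlgebra
  haveI hintAC : Algebra.IsIntegral A₂ C := by
    constructor
    intro x
    let gC : C →ₐ[A₂] K :=
      { toRingHom := C.val.toRingHom
        commutes' := fun b => rfl }
    have hgC : Function.Injective gC := Subtype.val_injective
    rw [← isIntegral_algHom_iff gC hgC]
    change IsIntegral A₂ (x : K)
    have hCle : C ≤ (integralClosure A₂ K).restrictScalars k := by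
      apply Algebra.adjoin_le
      rintro a (ha | ha)
      · change IsIntegral A₂ a
        exact isIntegral_algebraMap (R := A₂) (x := ⟨a, ha⟩)
      · change IsIntegral A₂ a
        apply IsIntegral.of_pow hp
        exact isIntegral_algebraMap (R := A₂) (x := ⟨a ^ p, hAp a ha⟩)
    exact hCle x.2
  have hmaxA₂ : (subringCentre A₂.toSubring O hA₂O).IsMaximal := by
    have h1 : ((subringCentre C.toSubring O hCO).comap (algebraMap A₂ C)).IsMaximal :=
      Ideal.isMaximal_comap_of_isIntegral_of_isMaximal _
    have h2 : (subringCentre C.toSubring O hCO).comap (algebraMap A₂ C) = subringCentre A₂.toSubring O hA₂O := by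
      ext a
      rw [Ideal.mem_comap, mem_subringCentre_iff, mem_subringCentre_iff]
      rfl
    rw [← h2]
    exact h1
  have hdimA₂ : ringKrullDim A₂ = 3 := by
    have h1 := Literature.RingTheory.KrullDimension.ringKrullDim_eq_of_isIntegral (R := A₂) (S := C)
      (Subalgebra.inclusion_injective hA₂C)
    rw [h1, Summit.ResolutionOfSingularities.ResolutionOfSingularities.Theorems.RadicialJung.CleanModels.ringKrullDim_eq_of_fg_of_le
      hAfg hCfg hAC, hdimA]
  refine ⟨hmaxA₂, hdimA₂, ?_⟩
  rw [Summit.ResolutionOfSingularities.ResolutionOfSingularities.Theorems.RadicialJung.CleanModels.ringKrullDim_locAtCentre_eq_of_isMaximal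
    A₂ hA₂fg O hA₂O hmaxA₂, hdimA₂]


end PortTwo

end Summit.ResolutionOfSingularities.ResolutionOfSingularities.Theorems.RadicialJung.CleanModels.Lens5.PRankTwoAssembly

end
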